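import Summits.QuantumFields.QCD.Theses.OverlapPositivityTransfer
import Summits.QuantumFields.QCD.Theorems.OverlapPositivityTransferOverlapMeasurePositivityFreeDet
import Literature.MathematicalPhysics.QuantumFieldTheory.OverlapQCDOSDirac
import Literature.MathematicalPhysics.QuantumFieldTheory.Balaban1983to89.FieldMeasureAnalyticZeroSetNull
import HarnessLib
import Literature.MathematicalPhysics.QuantumFieldTheory.QCDPhaseQuenched

/-!
# Route `OverlapPositivityTransfer` (QCD): the support item `OverlapMeasurePositivity` (stmt-QuantumFields-11155)

THE `N_f`-FLAVOUR ADMISSIBLE-OVERLAP GAUGE MARGINAL IS A POSITIVE MEASURE — all three clauses of the item, closed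
by `overlapPositivityTransfer_overlapMeasurePositivity_proof` (end of file):

* (i) `ae_det_gammaFive_mul_wilsonDirac_ne_zero` — for every torus, product-Haar-a.e. `SU(3)` gauge field has an
  invertible Hermitian Wilson kernel, `det(Γ₅ · D_W(U,−1,1)) ≠ 0` (so Neuberger's `sign` is a genuine involution).
  The functional extends to ALL tuples of `3 × 3` complex matrices as a polynomial in the entries and their
  conjugates (link inverses read as conjugate transposes), hence is real-analytic on the ambient product space
  (`analyticAt_det`, Leibniz expansion); it does not vanish at the free field (sibling module
  `…OverlapMeasurePositivityFreeDet`, torus Fourier analysis); so its zero set on `SU(3)^{edges}` is null for product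
  Haar measure by the tree's several-variables real-analytic zero-set theorem
  `FieldMeasureAnalyticZeroSetNull.pi_haar_specialUnitaryGroup_zeroSet_eq_zero` ([BrockerTomDieck1985] IV (2.11),
  [Mityagin2015] Prop. 1).
* (ii) the Gaussian Berezin evaluation is the tree's `fermiIntegral_overlapBoltzmann`.
* (iii) `integral_prod_det_re_mul_weight_pos` — `0 < ∫ (∏_f Re det D_{μ_f}(U)) · w_β(U) dU` for `β ≥ 0` and
  positive bare masses: off the exceptional set each `Re det D_{μ_f}(U) > 0` (tree `qcdOverlapDirac_det_re_pos`,
  [Neuberger1998] eq. (10)) and the integrand is CONTINUOUS there (Neuberger's `sign(H)` is a continuous functional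
  calculus away from `0`: Mathlib `ContinuousOn.cfc_of_mem_nhdsSet` in the `L²`-operator C⋆-norm), hence
  a.e.-strongly measurable; it is bounded (unitarity of `V = Γ₅ sign H`), hence integrable; it is `≥ 0` a.e. and
  `> 0` on the open neighbourhood `{det H ≠ 0} ∩ {all plaquettes admissible}` of the free field, which has
  positive product-Haar mass (`IsOpenPosMeasure`).

No summit, leg or crux statement is proved; QCD is NOT constructed by any of this.
-/

set_option autoImplicit false

noncomputable section

open MeasureTheory Matrix Complex
open scoped Matrix.Norms.L2Operator BigOperators
open Literature.MathematicalPhysics.QuantumLattice Literature.MathematicalPhysics.QuantumFieldTheory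
  Literature.Probability.LatticeModels
open Literature.MathematicalPhysics.QuantumFieldTheory.Balaban1983to89.FieldMeasureAnalyticZeroSetNull
  (pi_haar_specialUnitaryGroup_zeroSet_eq_zero)

namespace Summit.QuantumFields.QCD.Theorems.OverlapMeasurePositivity

/-! ## Part (iii): continuity of the overlap operator off the exceptional set, integrability, positivity -/

/-- If every entry of a matrix-valued function is real-analytic at `c`, so is its determinant
(Leibniz expansion: a finite sum of finite products). [folklore] -/
theorem analyticAt_det {E : Type*} [NormedAddCommGroup E] [NormedSpace ℝ E] {m : Type*} [Fintype m]
    [DecidableEq m] {f : E → Matrix m m ℂ} {c : E} (h : ∀ i j, AnalyticAt ℝ (fun x => f x i j) c) :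
    AnalyticAt ℝ (fun x => (f x).det) c := by
  simp only [Matrix.det_apply]
  refine Finset.analyticAt_fun_sum _ fun σ _ => ?_
  have hσ : (fun x => Equiv.Perm.sign σ • ∏ i, f x (σ i) i) =
      fun x => ((Equiv.Perm.sign σ : ℤ) : ℂ) * ∏ i, f x (σ i) i := by
    funext x
    rw [Units.smul_def, zsmul_eq_mul]
  rw [hσ]
  exact analyticAt_const.mul (Finset.analyticAt_fun_prod _ fun i _ => h _ _)

/-! ## The ambient (polynomial) extension of `Γ₅ D_W(·,−1,1)` to all matrix tuples -/

variable {S : ℕ} [NeZero S]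

/-- One matrix entry of one link variable, `M ↦ (M e)_{ab}`, is real-analytic (an `ℝ`-linear continuous map).
[folklore] -/
theorem analyticAt_entry (e : Edge 4 S) (a b : Fin 3) (M₀ : Edge 4 S → Matrix (Fin 3) (Fin 3) ℂ) :
    AnalyticAt ℝ (fun M : Edge 4 S → Matrix (Fin 3) (Fin 3) ℂ => M e a b) M₀ := by
  let l : (Edge 4 S → Matrix (Fin 3) (Fin 3) ℂ) →ₗ[ℝ] ℂ :=
    { toFun := fun M => M e a b
      map_add' := fun _ _ => rfl
      map_smul' := fun _ _ => rfl }
  have hl : Continuous l := by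
    show Continuous fun M : Edge 4 S → Matrix (Fin 3) (Fin 3) ℂ => M e a b
    exact ((continuous_apply e).matrix_elem a b)
  exact (⟨l, hl⟩ : (Edge 4 S → Matrix (Fin 3) (Fin 3) ℂ) →L[ℝ] ℂ).analyticAt M₀

/-- The conjugated entry `M ↦ ((M e)ᴴ)_{ab}` is real-analytic. [folklore] -/
theorem analyticAt_entry_conjTranspose (e : Edge 4 S) (a b : Fin 3)
    (M₀ : Edge 4 S → Matrix (Fin 3) (Fin 3) ℂ) :
    AnalyticAt ℝ (fun M : Edge 4 S → Matrix (Fin 3) (Fin 3) ℂ => (M e)ᴴ a b) M₀ := by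
  simp only [Matrix.conjTranspose_apply, RCLike.star_def]
  exact (Complex.conjCLE.toContinuousLinearMap.analyticAt _).comp (analyticAt_entry e b a M₀)

/-- **Clause (i) of `OverlapMeasurePositivity`: THE OVERLAP EXCEPTIONAL SET IS HAAR-NULL.**  For every torus
side `S ≥ 1`, `(⊗_e Haar){U ∈ SU(3)^{edges} : det(Γ₅ · D_W(U,−1,1)) = 0} = 0`, i.e. product-Haar-a.e. `U` has an
invertible Hermitian Wilson kernel.  [cite: BrockerTomDieck1985, IV (2.11) (proof)] [cite: Mityagin2015, Proposition 1]
[cite: Neuberger1998, eq. (8)] -/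
theorem ae_det_gammaFive_mul_wilsonDirac_ne_zero (S : ℕ) [NeZero S] :
    ∀ᵐ U ∂(Measure.pi fun _ : Edge 4 S => haarProbability (Matrix.specialUnitaryGroup (Fin 3) ℂ)),
      (spinorLift gammaFive * wilsonDirac (fundamentalRep (Fin 3)) U (-1) 1).det ≠ 0 := by
  -- the ambient functional: link inverses read as conjugate transposes
  set F : (Edge 4 S → Matrix (Fin 3) (Fin 3) ℂ) → ℂ := fun M =>
    (spinorLift (L := S) (N := 3) gammaFive *
      Matrix.of fun p q : TorusSite 4 S × Fin 3 × Fin 4 =>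
        (if p = q then (((-1 : ℝ) + 4 * (1 : ℝ) : ℝ) : ℂ) else 0) -
          (1 / 2 : ℂ) * ∑ μ : Fin 4,
            ((if q.1 = Literature.MathematicalPhysics.QuantumFieldTheory.Site.shift p.1 μ then
                (((1 : ℝ) : ℂ) • (1 : Matrix (Fin 4) (Fin 4) ℂ) - euclideanGamma μ) p.2.2 q.2.2 *
                  M (p.1, μ) p.2.1 q.2.1 else 0) +
              (if p.1 = Literature.MathematicalPhysics.QuantumFieldTheory.Site.shift q.1 μ then
                (((1 : ℝ) : ℂ) • (1 : Matrix (Fin 4) (Fin 4) ℂ) + euclideanGamma μ) p.2.2 q.2.2 *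
                  (M (q.1, μ))ᴴ p.2.1 q.2.1 else 0))).det with hFdef
  -- it is real-analytic on the whole ambient space
  have hF : AnalyticOnNhd ℝ F Set.univ := by
    intro M₀ _
    refine analyticAt_det fun p q => ?_
    simp only [Matrix.mul_apply, Matrix.of_apply]
    refine Finset.analyticAt_fun_sum _ fun r _ => analyticAt_const.mul ?_
    refine AnalyticAt.sub analyticAt_const (analyticAt_const.mul ?_)
    refine Finset.analyticAt_fun_sum _ fun μ _ => AnalyticAt.add ?_ ?_
    · split_ifs
      · exact analyticAt_const.mul (analyticAt_entry _ _ _ _)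
      · exact analyticAt_const
    · split_ifs
      · exact analyticAt_const.mul (analyticAt_entry_conjTranspose _ _ _ _)
      · exact analyticAt_const
  -- on `SU(3)`-valued configurations it IS `det(Γ₅ D_W(U,−1,1))`
  have hFU : ∀ U : GaugeConfig 4 S (Matrix.specialUnitaryGroup (Fin 3) ℂ),
      F (fun e => ((U e : Matrix.specialUnitaryGroup (Fin 3) ℂ) : Matrix (Fin 3) (Fin 3) ℂ)) =
        (spinorLift gammaFive * wilsonDirac (fundamentalRep (Fin 3)) U (-1) 1).det := by
    intro U
    rfl
  -- the witness: the free field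
  have hne : ∃ g₀ : Edge 4 S → Matrix.specialUnitaryGroup (Fin 3) ℂ,
      F (fun e => ((g₀ e : Matrix.specialUnitaryGroup (Fin 3) ℂ) : Matrix (Fin 3) (Fin 3) ℂ)) ≠ 0 :=
    ⟨1, by rw [hFU]; exact det_gammaFive_mul_wilsonDirac_one_ne_zero⟩
  haveI : (haarProbability (Matrix.specialUnitaryGroup (Fin 3) ℂ)).IsHaarMeasure := by
    unfold haarProbability; infer_instance
  have h0 := pi_haar_specialUnitaryGroup_zeroSet_eq_zero (ι := Edge 4 S) hF
    (haarProbability (Matrix.specialUnitaryGroup (Fin 3) ℂ)) hne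
  rw [ae_iff]
  simpa only [hFU, not_not] using h0

end Summit.QuantumFields.QCD.Theorems.OverlapMeasurePositivity

end



/-!
# Route `OverlapPositivityTransfer` (QCD): the support item `OverlapMeasurePositivity` (stmt-QuantumFields-11155)

THE `N_f`-FLAVOUR ADMISSIBLE-OVERLAP GAUGE MARGINAL IS A POSITIVE MEASURE.  Clause (i) — the exceptional set
`det(Γ₅ D_W(U,−1,1)) = 0` is product-Haar-null — is `ae_det_gammaFive_mul_wilsonDirac_ne_zero` (sibling module,
real-analytic zero sets); clause (ii) — the Gaussian Berezin evaluation — is the tree's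
`fermiIntegral_overlapBoltzmann`; clause (iii) — `0 < ∫ (∏_f Re det D_{μ_f}(U)) · w_β(U) dU` — is proved here:
off the exceptional set each `Re det D_{μ_f}(U) > 0` (tree `qcdOverlapDirac_det_re_pos`, [Neuberger1998] eq. (10))
and the integrand is CONTINUOUS there (Neuberger's `sign(H)` is a continuous functional calculus away from `0`,
Mathlib `ContinuousOn.cfc_of_mem_nhdsSet` in the `L²`-operator C⋆-norm), hence a.e.-strongly measurable; it is
bounded (unitarity of `V = Γ₅ sign H`), hence integrable; it is `≥ 0` a.e. and `> 0` on the open neighbourhood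
`{det H ≠ 0} ∩ {all plaquettes admissible}` of the free field, which has positive product-Haar mass
(`IsOpenPosMeasure`).  No summit, leg or crux statement is proved; QCD is NOT constructed by any of this.
-/

set_option autoImplicit false

noncomputable section

open MeasureTheory Matrix Complex Filter Topology
open scoped Matrix.Norms.L2Operator BigOperators
open Literature.MathematicalPhysics.QuantumLattice Literature.MathematicalPhysics.QuantumFieldTheory
  Literature.Probability.LatticeModels

namespace Summit.QuantumFields.QCD.Theorems.OverlapMeasurePositivity

variable {S : ℕ} [NeZero S]

/-! ## Continuity of the overlap operator off the exceptional set -/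

/-- `Real.sign` is continuous away from `0` (locally constant there). [folklore] -/
theorem continuousOn_real_sign : ContinuousOn Real.sign {x : ℝ | x ≠ 0} := by
  intro x hx
  rcases lt_or_gt_of_ne hx with h | h
  · have hev : Real.sign =ᶠ[nhds x] fun _ => -1 := by
      filter_upwards [gt_mem_nhds h] with y hy
      exact Real.sign_of_neg hy
    exact (continuousAt_const.congr_of_eventuallyEq hev).continuousWithinAt
  · have hev : Real.sign =ᶠ[nhds x] fun _ => 1 := by
      filter_upwards [lt_mem_nhds h] with y hy
      exact Real.sign_of_pos hy
    exact (continuousAt_const.congr_of_eventuallyEq hev).continuousWithinAt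

/-- The Hermitian Wilson kernel `U ↦ H(U) = Γ₅ · D_W(U,−1,1)` depends continuously on the gauge field.
[cite: Neuberger1998, eq. (8)] -/
theorem continuous_overlapKernel :
    Continuous fun U : GaugeConfig 4 S (Matrix.specialUnitaryGroup (Fin 3) ℂ) =>
      spinorLift gammaFive * wilsonDirac (fundamentalRep (Fin 3)) U (-1) 1 :=
  continuous_const.mul (continuous_wilsonDirac (fundamentalRep (Fin 3)) (continuous_fundamentalRep _) (-1) 1)

/-- **Neuberger's operator is continuous off the exceptional set**: on the open set `{U : det H(U) ≠ 0}` the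
massive overlap operator `U ↦ D_μ(U) = (1+μ/2)·1 + (1−μ/2)·Γ₅ sign(H(U))` is continuous (the spectra stay in
`ℝ ∖ {0}`, where `sign` is continuous; Mathlib's continuity of the functional calculus in the operator).
[cite: Neuberger1998, eqs. (8)–(9)] [cite: HernandezJansenLuscher1999, §2.5] -/
theorem continuousOn_qcdOverlapDirac (μ : ℝ) :
    ContinuousOn (fun U : GaugeConfig 4 S (Matrix.specialUnitaryGroup (Fin 3) ℂ) => qcdOverlapDirac U μ)
      {U | (spinorLift gammaFive * wilsonDirac (fundamentalRep (Fin 3)) U (-1) 1).det ≠ 0} := by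
  set O := {U : GaugeConfig 4 S (Matrix.specialUnitaryGroup (Fin 3) ℂ) |
    (spinorLift gammaFive * wilsonDirac (fundamentalRep (Fin 3)) U (-1) 1).det ≠ 0} with hO
  have hsa : ∀ U ∈ O, IsSelfAdjoint (spinorLift gammaFive * wilsonDirac (fundamentalRep (Fin 3)) U (-1) 1) :=
    fun U _ => overlapKernel_isHermitian (fundamentalRep (Fin 3)) fundamentalRep_mem_unitaryGroup U 1
  have hsp : ∀ U ∈ O, (0 : ℝ) ∉ spectrum ℝ (spinorLift gammaFive * wilsonDirac (fundamentalRep (Fin 3)) U (-1) 1) :=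
    fun U hU => spectrum.zero_notMem ℝ ((Matrix.isUnit_iff_isUnit_det _).mpr (isUnit_iff_ne_zero.mpr hU))
  have hs : {x : ℝ | x ≠ 0} ∈ 𝓝ˢ (⋃ U ∈ O,
      spectrum ℝ (spinorLift gammaFive * wilsonDirac (fundamentalRep (Fin 3)) U (-1) 1)) := by
    refine isOpen_ne.mem_nhdsSet.mpr ?_
    intro y hy
    simp only [Set.mem_iUnion] at hy
    obtain ⟨U, hU, hyU⟩ := hy
    intro h0
    exact hsp U hU (h0 ▸ hyU)
  have hsign : ContinuousOn (fun U : GaugeConfig 4 S (Matrix.specialUnitaryGroup (Fin 3) ℂ) =>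
      cfc Real.sign (spinorLift gammaFive * wilsonDirac (fundamentalRep (Fin 3)) U (-1) 1)) O :=
    ContinuousOn.cfc_of_mem_nhdsSet Real.sign hs continuous_overlapKernel.continuousOn hsa
      (continuousOn_real_sign.mono fun _ h => h)
  have hφ : Continuous fun A : Matrix (TorusSite 4 S × Fin 3 × Fin 4) (TorusSite 4 S × Fin 3 × Fin 4) ℂ =>
      ((1 + μ / 2 : ℝ) : ℂ) • (1 : Matrix (TorusSite 4 S × Fin 3 × Fin 4) (TorusSite 4 S × Fin 3 × Fin 4) ℂ) +
        ((1 - μ / 2 : ℝ) : ℂ) • (spinorLift (L := S) (N := 3) gammaFive * A) := by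
    fun_prop
  show ContinuousOn (fun U => qcdOverlapDirac U μ) O
  unfold qcdOverlapDirac
  exact hφ.comp_continuousOn hsign

/-- The integrand's fermionic factor `U ↦ ∏_f Re det D_{μ_f}(U)` is continuous off the exceptional set.
[cite: Neuberger1998, eq. (10)] -/
theorem continuousOn_prod_det_re {Nf : ℕ} (μ : Fin Nf → ℝ) :
    ContinuousOn (fun U : GaugeConfig 4 S (Matrix.specialUnitaryGroup (Fin 3) ℂ) =>
        ∏ f, (qcdOverlapDirac U (μ f)).det.re)
      {U | (spinorLift gammaFive * wilsonDirac (fundamentalRep (Fin 3)) U (-1) 1).det ≠ 0} := by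
  refine continuousOn_finsetProd _ fun f _ => ?_
  exact Complex.continuous_re.comp_continuousOn
    ((continuous_id.matrix_det).comp_continuousOn (continuousOn_qcdOverlapDirac (μ f)))

/-! ## Boundedness of the fermionic factor off the exceptional set -/

/-- Leibniz bound: if all entries of `A` have norm `≤ K` then `‖det A‖ ≤ (#n)! · K^{#n}`. [folklore] -/
theorem norm_det_le_of_entry_le {n : Type*} [Fintype n] [DecidableEq n] {A : Matrix n n ℂ} {K : ℝ}
    (hK : ∀ i j, ‖A i j‖ ≤ K) : ‖A.det‖ ≤ (Fintype.card n).factorial * K ^ Fintype.card n := by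
  rw [Matrix.det_apply]
  calc ‖∑ σ : Equiv.Perm n, Equiv.Perm.sign σ • ∏ i, A (σ i) i‖
      ≤ ∑ σ : Equiv.Perm n, ‖Equiv.Perm.sign σ • ∏ i, A (σ i) i‖ := norm_sum_le _ _
    _ ≤ ∑ σ : Equiv.Perm n, K ^ Fintype.card n := by
        refine Finset.sum_le_sum fun σ _ => ?_
        rw [Units.smul_def, zsmul_eq_mul, norm_mul]
        have h1 : ‖(((Equiv.Perm.sign σ : ℤˣ) : ℤ) : ℂ)‖ = 1 := by
          rcases Int.units_eq_one_or (Equiv.Perm.sign σ) with h | h <;> simp [h]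
        rw [h1, one_mul]
        calc ‖∏ i, A (σ i) i‖ ≤ ∏ i, ‖A (σ i) i‖ := Finset.norm_prod_le _ _
          _ ≤ ∏ _i : n, K := Finset.prod_le_prod (fun i _ => norm_nonneg _) fun i _ => hK _ _
          _ = K ^ Fintype.card n := by rw [Finset.prod_const, Finset.card_univ]
    _ = (Fintype.card n).factorial * K ^ Fintype.card n := by
        rw [Finset.sum_const, Finset.card_univ, Fintype.card_perm, nsmul_eq_mul]

/-- Entries of Neuberger's operator `D_μ(U) = (1+μ/2)·1 + (1−μ/2)·V` are bounded by `|1+μ/2| + |1−μ/2|` off the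
exceptional set (`V = Γ₅ sign H` is unitary, so its entries have modulus `≤ 1`). [cite: Neuberger1998, eq. (9)] -/
theorem norm_qcdOverlapDirac_apply_le (U : GaugeConfig 4 S (Matrix.specialUnitaryGroup (Fin 3) ℂ)) (μ : ℝ)
    (hU : (spinorLift gammaFive * wilsonDirac (fundamentalRep (Fin 3)) U (-1) 1).det ≠ 0)
    (i j : TorusSite 4 S × Fin 3 × Fin 4) :
    ‖qcdOverlapDirac U μ i j‖ ≤ |1 + μ / 2| + |1 - μ / 2| := by
  have hV : overlapUnitary (fundamentalRep (Fin 3)) U 1 ∈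
      Matrix.unitaryGroup (TorusSite 4 S × Fin 3 × Fin 4) ℂ :=
    overlapUnitary_mem_unitaryGroup (fundamentalRep (Fin 3)) fundamentalRep_mem_unitaryGroup U 1 hU
  have hentry : qcdOverlapDirac U μ i j =
      ((1 + μ / 2 : ℝ) : ℂ) * (1 : Matrix (TorusSite 4 S × Fin 3 × Fin 4) (TorusSite 4 S × Fin 3 × Fin 4) ℂ) i j +
        ((1 - μ / 2 : ℝ) : ℂ) * overlapUnitary (fundamentalRep (Fin 3)) U 1 i j := rfl
  have h1 : ‖(1 : Matrix (TorusSite 4 S × Fin 3 × Fin 4) (TorusSite 4 S × Fin 3 × Fin 4) ℂ) i j‖ ≤ 1 := by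
    rw [Matrix.one_apply]
    split_ifs <;> simp
  rw [hentry]
  refine (norm_add_le _ _).trans (add_le_add ?_ ?_)
  · rw [norm_mul, Complex.norm_real, Real.norm_eq_abs]
    exact (mul_le_mul_of_nonneg_left h1 (abs_nonneg _)).trans_eq (mul_one _)
  · rw [norm_mul, Complex.norm_real, Real.norm_eq_abs]
    exact (mul_le_mul_of_nonneg_left (entry_norm_bound_of_unitary hV i j) (abs_nonneg _)).trans_eq (mul_one _)

/-- The fermionic factor is bounded off the exceptional set by the explicit constant
`∏_f (#n)! · (|1+μ_f/2| + |1−μ_f/2|)^{#n}`, `n` = the fermion index set. [cite: Neuberger1998, eq. (10)] -/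
theorem norm_prod_det_re_le {Nf : ℕ} (μ : Fin Nf → ℝ) (U : GaugeConfig 4 S (Matrix.specialUnitaryGroup (Fin 3) ℂ))
    (hU : (spinorLift gammaFive * wilsonDirac (fundamentalRep (Fin 3)) U (-1) 1).det ≠ 0) :
    ‖∏ f, (qcdOverlapDirac U (μ f)).det.re‖ ≤
      ∏ f, ((Fintype.card (TorusSite 4 S × Fin 3 × Fin 4)).factorial *
        (|1 + μ f / 2| + |1 - μ f / 2|) ^ Fintype.card (TorusSite 4 S × Fin 3 × Fin 4) : ℝ) := by
  rw [norm_prod]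
  refine Finset.prod_le_prod (fun _ _ => norm_nonneg _) fun f _ => ?_
  rw [Real.norm_eq_abs]
  exact (Complex.abs_re_le_norm _).trans (norm_det_le_of_entry_le (norm_qcdOverlapDirac_apply_le U (μ f) hU))

/-! ## Clause (iii): the partition function is strictly positive -/

/-- **Clause (iii) of `OverlapMeasurePositivity`**: for `β ≥ 0`, every torus and all positive bare masses,
`0 < ∫ (∏_f Re det D_{μ_f}(U)) · w_β(U) d(⊗_e Haar)`.  The integrand is a.e.-strongly measurable (continuous on
the open full-measure set `{det H ≠ 0}` times the measurable admissible weight), bounded, non-negative a.e., and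
strictly positive on the open neighbourhood `{det H ≠ 0} ∩ {∀ p, 3 − Re tr Uₚ < 1/1800}` of the free field, which
has positive product-Haar mass. [cite: Neuberger1998, eq. (10)] [cite: Luscher1999AbelianChiral, §2 (2.9)]
[cite: MontvayMunster1994, §5.1] -/
theorem integral_prod_det_re_mul_weight_pos {Nf : ℕ} (S : ℕ) [NeZero S] (β : ℝ) (μ : Fin Nf → ℝ)
    (hβ : 0 ≤ β) (hμ : ∀ f, 0 < μ f) :
    0 < ∫ U, (∏ f, (qcdOverlapDirac U (μ f)).det.re) * overlapGaugeWeight β U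
      ∂(Measure.pi fun _ : Edge 4 S => haarProbability (Matrix.specialUnitaryGroup (Fin 3) ℂ)) := by
  haveI : (haarProbability (Matrix.specialUnitaryGroup (Fin 3) ℂ)).IsHaarMeasure := by
    unfold haarProbability; infer_instance
  set πμ : Measure (GaugeConfig 4 S (Matrix.specialUnitaryGroup (Fin 3) ℂ)) :=
    Measure.pi fun _ : Edge 4 S => haarProbability (Matrix.specialUnitaryGroup (Fin 3) ℂ) with hπμ
  set O : Set (GaugeConfig 4 S (Matrix.specialUnitaryGroup (Fin 3) ℂ)) :=
    {U | (spinorLift gammaFive * wilsonDirac (fundamentalRep (Fin 3)) U (-1) 1).det ≠ 0} with hO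
  have hOopen : IsOpen O := isOpen_ne_fun (continuous_overlapKernel.matrix_det) continuous_const
  have hOae : ∀ᵐ U ∂πμ, U ∈ O := ae_det_gammaFive_mul_wilsonDirac_ne_zero S
  -- the plaquette functions and the admissible weight
  have ht : ∀ p : Plaquette 4 S, Continuous fun U : GaugeConfig 4 S (Matrix.specialUnitaryGroup (Fin 3) ℂ) =>
      3 - ((fundamentalRep (Fin 3)) (plaquetteHolonomy U p.1 p.2.1.1 p.2.1.2)).trace.re := by
    intro p
    have hc : Continuous fun U : GaugeConfig 4 S (Matrix.specialUnitaryGroup (Fin 3) ℂ) =>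
        plaquetteHolonomy U p.1 p.2.1.1 p.2.1.2 := by
      unfold plaquetteHolonomy; fun_prop
    exact continuous_const.sub (Complex.continuous_re.comp
      ((continuous_id.matrix_trace).comp ((continuous_fundamentalRep _).comp hc)))
  have hcut : Measurable (overlapGaugeCut β) := by
    refine Measurable.ite measurableSet_Iio ?_ measurable_const
    fun_prop
  have hw : Measurable fun U : GaugeConfig 4 S (Matrix.specialUnitaryGroup (Fin 3) ℂ) => overlapGaugeWeight β U :=
    Finset.measurable_prod _ fun p _ => hcut.comp (ht p).measurable
  -- the integrand is a.e.-strongly measurable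
  have hg₁m : AEStronglyMeasurable (fun U : GaugeConfig 4 S (Matrix.specialUnitaryGroup (Fin 3) ℂ) =>
      ∏ f, (qcdOverlapDirac U (μ f)).det.re) πμ := by
    have h := (continuousOn_prod_det_re (S := S) μ).aestronglyMeasurable (μ := πμ) hOopen.measurableSet
    rwa [Measure.restrict_eq_self_of_ae_mem hOae] at h
  have hgm : AEStronglyMeasurable (fun U : GaugeConfig 4 S (Matrix.specialUnitaryGroup (Fin 3) ℂ) =>
      (∏ f, (qcdOverlapDirac U (μ f)).det.re) * overlapGaugeWeight β U) πμ :=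
    hg₁m.mul hw.aestronglyMeasurable
  -- bounded, hence integrable
  set C : ℝ := ∏ f : Fin Nf, ((Fintype.card (TorusSite 4 S × Fin 3 × Fin 4)).factorial *
      (|1 + μ f / 2| + |1 - μ f / 2|) ^ Fintype.card (TorusSite 4 S × Fin 3 × Fin 4) : ℝ) with hC
  have hC0 : 0 ≤ C := Finset.prod_nonneg fun f _ => by positivity
  have hbound : ∀ᵐ U ∂πμ, ‖(∏ f, (qcdOverlapDirac U (μ f)).det.re) * overlapGaugeWeight β U‖ ≤ C := by
    filter_upwards [hOae] with U hU
    rw [norm_mul, Real.norm_of_nonneg (overlapGaugeWeight_nonneg β U)]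
    calc ‖∏ f, (qcdOverlapDirac U (μ f)).det.re‖ * overlapGaugeWeight β U
        ≤ C * 1 := mul_le_mul (norm_prod_det_re_le μ U hU) (overlapGaugeWeight_le_one hβ U)
          (overlapGaugeWeight_nonneg β U) hC0
      _ = C := mul_one C
  have hint : Integrable (fun U : GaugeConfig 4 S (Matrix.specialUnitaryGroup (Fin 3) ℂ) =>
      (∏ f, (qcdOverlapDirac U (μ f)).det.re) * overlapGaugeWeight β U) πμ :=
    Integrable.mono' (integrable_const C) hgm hbound
  -- non-negative a.e.
  have hnonneg : 0 ≤ᵐ[πμ] fun U : GaugeConfig 4 S (Matrix.specialUnitaryGroup (Fin 3) ℂ) =>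
      (∏ f, (qcdOverlapDirac U (μ f)).det.re) * overlapGaugeWeight β U := by
    filter_upwards [hOae] with U hU
    exact mul_nonneg (Finset.prod_nonneg fun f _ => (qcdOverlapDirac_det_re_pos U (hμ f) hU).le)
      (overlapGaugeWeight_nonneg β U)
  -- strictly positive on an open neighbourhood of the free field
  set W : Set (GaugeConfig 4 S (Matrix.specialUnitaryGroup (Fin 3) ℂ)) :=
    ⋂ p : Plaquette 4 S, {U | 3 - ((fundamentalRep (Fin 3)) (plaquetteHolonomy U p.1 p.2.1.1 p.2.1.2)).trace.re <
      1 / 1800} with hW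
  have hWopen : IsOpen W := isOpen_iInter_of_finite fun p => isOpen_lt (ht p) continuous_const
  have h1O : (1 : GaugeConfig 4 S (Matrix.specialUnitaryGroup (Fin 3) ℂ)) ∈ O :=
    det_gammaFive_mul_wilsonDirac_one_ne_zero
  have h1W : (1 : GaugeConfig 4 S (Matrix.specialUnitaryGroup (Fin 3) ℂ)) ∈ W := by
    simp only [hW, Set.mem_iInter, Set.mem_setOf_eq]
    intro p
    have h1 : plaquetteHolonomy (1 : GaugeConfig 4 S (Matrix.specialUnitaryGroup (Fin 3) ℂ)) p.1 p.2.1.1 p.2.1.2 = 1 := by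
      simp [plaquetteHolonomy]
    rw [h1, map_one, Matrix.trace_one]
    norm_num
  have hpos : 0 < πμ (O ∩ W) := (hOopen.inter hWopen).measure_pos πμ ⟨1, h1O, h1W⟩
  have hsub : O ∩ W ⊆ Function.support (fun U : GaugeConfig 4 S (Matrix.specialUnitaryGroup (Fin 3) ℂ) =>
      (∏ f, (qcdOverlapDirac U (μ f)).det.re) * overlapGaugeWeight β U) := by
    rintro U ⟨hU, hUW⟩
    rw [Function.mem_support]
    have hW' : ∀ p : Plaquette 4 S,
        3 - ((fundamentalRep (Fin 3)) (plaquetteHolonomy U p.1 p.2.1.1 p.2.1.2)).trace.re < 1 / 1800 := by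
      simpa only [hW, Set.mem_iInter, Set.mem_setOf_eq] using hUW
    exact (mul_pos (Finset.prod_pos fun f _ => qcdOverlapDirac_det_re_pos U (hμ f) hU)
      ((overlapGaugeWeight_pos_iff β U).mpr hW')).ne'
  exact (integral_pos_iff_support_of_nonneg_ae hnonneg hint).mpr (hpos.trans_le (measure_mono hsub))

/-! ## The item -/

/-- **Item stmt-QuantumFields-11155 `OverlapPositivityTransfer.OverlapMeasurePositivity` holds**: the
`N_f`-flavour admissible-overlap gauge marginal is a positive measure — (i) the exceptional set
`det(Γ₅D_W(U,−1,1)) = 0` is product-Haar-null, (ii) the Gaussian Berezin integral of the overlap Boltzmann factor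
is `(−1)^{n(n−1)/2+n} ∏_f det D_{μ_f}(U)` (tree `fermiIntegral_overlapBoltzmann`), (iii) the determinant-weighted
admissible partition function is strictly positive for `β ≥ 0` and positive bare masses.
[cite: Neuberger1998, eqs. (8)–(10)] [cite: Luscher1999AbelianChiral, §2 (2.9)] [cite: MontvayMunster1994, §4.1 (4.17), §5.1]
[cite: BrockerTomDieck1985, IV (2.11)] -/
theorem overlapPositivityTransfer_overlapMeasurePositivity_proof :
    Summit.QuantumFields.QCD.Theses.OverlapPositivityTransfer.OverlapMeasurePositivity := by
  unfold Summit.QuantumFields.QCD.Theses.OverlapPositivityTransfer.OverlapMeasurePositivity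
  intro Nf S _ β μ hβ hμ
  exact ⟨ae_det_gammaFive_mul_wilsonDirac_ne_zero S, fun U => fermiIntegral_overlapBoltzmann U μ,
    integral_prod_det_re_mul_weight_pos S β μ hβ hμ⟩

end Summit.QuantumFields.QCD.Theorems.OverlapMeasurePositivity

end
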